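import Literature.AnabelianGeometry.EtaleTheta.Discharge.Sec2Cor219iiiPullbackImageEq
import Literature.AnabelianGeometry.EtaleTheta.Discharge.Sec2Cor219iiiHeartLocallyConstant
import Literature.AnabelianGeometry.EtaleTheta.Discharge.Sec2DeltaThetaTorsionFree
import HarnessLib

/-!
# [EtTh] Cor. 2.19 (iii), tower form (`ThetaEnvTower.Cor219_iii`, F-0650) — part 2f (GENERIC): the TOWER ASSEMBLY
# «compatible level-wise hearts ⇒ `Cor219_iii`» (roadmap G9), and its form at an origin (proof-only)

S. Mochizuki, *The étale theta function and its Frobenioid-theoretic manifestations*, Publ. RIMS **45** (2009)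
[EtTh], §2, Cor. 2.19 (iii), PRIMS PDF p. 65 ("by allowing `N` to vary among all [elements of `E`] … preserves this collection
of classes … up to … some multiple"); Prop. 2.2 (iii) p. 37 ("`G_K ≅ Π_X̲̲/Δ_X̲̲`"); §1 p. 12 ("`(Ẑ(1) ≅) Δ_Θ`")
[cite: MochizukiEtTh2009, Cor 2.19(iii) p.65].

Cell `abc-iut`, seat abc-iut-C-hgal-2 (gen 6), K-L6 row «COR219III-G8b» (abc-iut-L6-lead §F v1.19bw (1), binder shapes of
§F v1.19ca (4) / STATUS 00:31:54Z), file 3 of the row; sequel of abc-iut-w4-d038's parts 1–2c (p467752, p470012, p470633,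
p474712), abc-iut-f-142's `Sec2Cor219iiiHeartLocallyConstant` (p477834: `transport_red_isLocallyConstant`,
`conjRoot_red_isLocallyConstant`, the Δ_P-heart `heart_of_dense_of_zpowers`), abc-iut-L2-t8's `Sec2DeltaThetaTorsionFree`
(`deltaTheta_torsionfree`) and files 1–2 of this row (`Sec2Cor219iiiCoboundaryTransport`, `Sec2Cor219iiiPullbackImageEq`).
PROOF-ONLY: no definition, no instance, no notation, no new named fact; everything consumed BY NAME.

WHAT IS SHOWN (`T := C.thetaEnvTower τ hC hS`):
* `red_conjRoot_eq_conjCocycle` — `red_M(conjRoot σ f₀ (g)) = Inn(σ)(red_M ∘ f₀)(g)` (abc-iut-L2-t2's `conjCocycle`).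
* **`cor219_iii_of_hearts` (G9).**  HYPOTHESES: `hT` («`Δ_Θ` has no `l`-torsion»); `hopen` (`aug|_{Π^tp_Ÿ̲̲}` is an open map,
  roadmap D2); and for every `(γ, γ̄)` EXACTLY as quantified by `T.Cor219_iii`: (a) clauses (4), (5) of Cor. 2.18 (i) for `γ`;
  (b) for the induced `γ̃`: ONE root cocycle `f₀`, points `x : E → Π^tp_X̲̲`, (b1) the level-wise Δ_P-HEART
  «`red_M(γ̃⁻¹ f₀(γ k)) = red_M(conjRoot x_M f₀ (k))` for `k ∈ Π^tp_Ÿ̲̲ ∩ Ker aug» (the OUTPUT shape of abc-iut-f-142's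
  `heart_of_dense_of_zpowers`, i.e. roadmap M1) and (b2) the LEVEL COMPATIBILITY «`red_M ∘ conjRoot x_{M'} f₀ =
  red_M ∘ conjRoot x_M f₀` on `Π^tp_Ÿ̲̲` for `M ∣ M'`» (roadmap M2).  CONCLUSION: `T.Cor219_iii`.  PROOF: the level-`M` quotient
  `q_M := (red_M ∘ Φ_γ f₀)/(red_M ∘ conjRoot x_M f₀)` is a locally constant mod-`M` cocycle on `Π^tp_Ÿ̲̲` vanishing on `Δ_P`, hence
  `c_M ∘ aug` for a `G_K`-cocycle `c_M` with `c_M ∘ aug` locally constant (part 2a `exists_envCocycle_of_vanishing`); the `c_M` are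
  compatible by `CyclotomeTower.red_mod` and (b2); and `q_M = c_M ∘ aug` IS the full heart of parts 2c/2e, so the level-`M` clause
  is `pullback_image_eq_of_heart_of_noTorsion` (file 2).
* `isOpenMap_aug_PiYdd` — `hopen` holds as soon as `aug : Π^tp_X → G_{ℚ_p}` itself is an open map.
* **`cor219_iii_of_hearts_of_origin`** — at an origin (`D.IsEtThOrigin`) the binder `hT` is abc-iut-L2-t8's theorem
  `deltaTheta_torsionfree`, so only `hopen` and the per-`γ` packages (a), (b1), (b2) remain (the model content M1/M2 of the K-L6
  row «COR219III-M1b»).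

HONEST FRAMING: unconditional statements about OUR typed objects over an arbitrary §1 setting; nothing of [EtTh] (refereed)
is asserted beyond what is proved; no side is taken on [IUTchIII] Cor. 3.12; typed ≠ proved; nothing asserts abc proved or
refuted.
-/

noncomputable section

namespace Literature.AnabelianGeometry.EtaleTheta

open Literature.AnabelianGeometry.SemiGraphs
open scoped IsMulCommutative

namespace ThetaSetting.EtaleThetaData.DoubleUnderline

variable {p : ℕ} [Fact p.Prime] {D : ThetaSetting p} {E : D.EtaleThetaData} {l : ℕ}
  (C : E.DoubleUnderline l) {Es : Set ℕ+} (τ : D.CyclotomeTower l Es)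

/-! ## §1. G9: the tower assembly «compatible level-wise hearts ⇒ `ThetaEnvTower.Cor219_iii`» -/

/-- `red_M(conjRoot σ f₀ (g)) = Inn(σ)(red_M ∘ f₀)(g)`: the reduction of the `σ`-conjugate root cocycle is abc-iut-L2-t2's
`conjCocycle M σ` of the reduction (`(l·Δ_Θ) ↠ μ_M` is `G_K`-equivariant). [cite: MochizukiEtTh2009, Cor 2.16 p.54] -/
theorem red_conjRoot_eq_conjCocycle (hC : D.Compat) (hS : D.Sec2Hyps) (M : Es)
    (f₀ : contCocycles D.toTheta D.DeltaTheta C.GtpYdduu) (hf₀ : f₀ ∈ C.rootCocycles hC)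
    (σ : (C.thetaEnvTower τ hC hS).PiX) (g : (C.thetaEnvTower τ hC hS).PiYdd) :
    (τ.mod M).red ⟨(C.conjRoot hC σ f₀.1 (C.inclYdduu g) : D.GtpTheta), (D.lDeltaTheta_normal l).conj_mem _ (hf₀.1 _) _⟩ =
      (C.thetaEnvTower τ hC hS).conjCocycle M σ (C.modN (τ.mod M) f₀ hf₀.1) g := by
  have hσmem : σ⁻¹ * (g : (C.thetaEnvTower τ hC hS).PiX) * σ ∈ (C.thetaEnvTower τ hC hS).PiYdd := by
    simpa [mul_assoc] using (C.thetaEnvTower τ hC hS).PiYdd_normal.conj_mem _ g.2 σ⁻¹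
  change _ = galMuN p M (D.aug.toMonoidHom ((σ : (C.thetaEnvTower τ hC hS).PiX) : D.PiTemp))
    ((τ.mod M).red ⟨(f₀.1 (C.inclYdduu ⟨_, hσmem⟩) : D.GtpTheta), hf₀.1 _⟩)
  rw [← (τ.mod M).red_conj]
  congr 1

/-- **G9 (tower assembly): compatible level-wise hearts ⇒ `ThetaEnvTower.Cor219_iii`.**  Let `T := C.thetaEnvTower τ hC hS` be
the §1-instantiated tower over a theta setting whose `Δ_Θ` has no `l`-torsion and whose augmentation is open on `Π^tp_Ÿ̲̲`.
Suppose that for every bi-continuous `γ` stabilising `Π^tp_Ÿ̲̲` and every admitted coefficient family `(γ̄_M)_M` — the data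
quantified by `T.Cor219_iii` — (a) `γ` satisfies clauses (4), (5) of Cor. 2.18 (i) (`Ker(Π^tp_X̲̲ → (Π^tp_X)^Θ)` and
`θ⁻¹(l·Δ_Θ)` stable), and (b) for the induced `γ̃` there are ONE root cocycle `f₀`, points `x_M ∈ Π^tp_X̲̲` and, at every level
`M`, the Δ_P-HEART «`red_M(γ̃⁻¹ f₀(γ k)) = red_M(conjRoot x_M f₀ (k))` on `Π^tp_Ÿ̲̲ ∩ Ker aug`» (abc-iut-f-142's
`heart_of_dense_of_zpowers` output) with the `x_M` COMPATIBLE across levels («`red_M ∘ conjRoot x_{M'} f₀ = red_M ∘ conjRoot x_M f₀`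
for `M ∣ M'`», roadmap M2).  THEN `T.Cor219_iii` holds: the `G_K`-cocycles are `c_M := (red_M ∘ Φ_γ f₀)/(red_M ∘ conjRoot x_M f₀)`
descended through `aug` (part 2a `exists_envCocycle_of_vanishing`), compatible by `τ.red_mod`, and the level-`M` clause is
`pullback_image_eq_of_heart_of_noTorsion`. [cite: MochizukiEtTh2009, Cor 2.19(iii) p.65] -/
theorem cor219_iii_of_hearts (hC : D.Compat) (hS : D.Sec2Hyps)
    (hT : ∀ t : D.DeltaTheta, t ^ l = 1 → t = 1)
    (hopen : IsOpenMap fun g : (C.thetaEnvTower τ hC hS).PiYdd =>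
      (C.thetaEnvTower τ hC hS).aug (g : (C.thetaEnvTower τ hC hS).PiX))
    (H : ∀ (γ : (C.thetaEnvTower τ hC hS).PiX ≃ₜ* (C.thetaEnvTower τ hC hS).PiX)
      (hγ : (C.thetaEnvTower τ hC hS).PiYdd.map γ.toMulEquiv.toMonoidHom = (C.thetaEnvTower τ hC hS).PiYdd)
      (γμ : ∀ M : Es, (C.thetaEnvTower τ hC hS).mu M ≃* (C.thetaEnvTower τ hC hS).mu M)
      (_ : ∀ (M : Es) (g : (C.thetaEnvTower τ hC hS).lDeltaTheta) (hg : γ g ∈ (C.thetaEnvTower τ hC hS).lDeltaTheta),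
        (C.thetaEnvTower τ hC hS).thetaMod M ⟨γ g, hg⟩ = γμ M ((C.thetaEnvTower τ hC hS).thetaMod M g)),
      (D.toTheta.comp C.Huu.subtype).ker.map γ.toMulEquiv.toMonoidHom = (D.toTheta.comp C.Huu.subtype).ker ∧
      (C.thetaEnvTower τ hC hS).lDeltaTheta.map γ.toMulEquiv.toMonoidHom = (C.thetaEnvTower τ hC hS).lDeltaTheta ∧
      ∀ (γΛ : D.lDeltaTheta l ≃* D.lDeltaTheta l)
        (_ : ∀ (g : (C.thetaEnvTower τ hC hS).lDeltaTheta) (hg : γ g ∈ (C.thetaEnvTower τ hC hS).lDeltaTheta),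
          C.toLDelta ⟨γ g, hg⟩ = γΛ (C.toLDelta g)),
        ∃ (f₀ : contCocycles D.toTheta D.DeltaTheta C.GtpYdduu) (hf₀ : f₀ ∈ C.rootCocycles hC)
          (x : Es → (C.thetaEnvTower τ hC hS).PiX),
          (∀ (M : Es) (g : (C.thetaEnvTower τ hC hS).PiYdd), D.aug.toMonoidHom ((g : C.Huu) : D.PiTemp) = 1 →
            (τ.mod M).red (γΛ.symm ⟨(f₀.1 (C.inclYdduu ⟨γ g, C.apply_mem_PiYdd τ hC hS γ hγ g⟩) : D.GtpTheta),
              hf₀.1 _⟩) =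
              (τ.mod M).red ⟨(C.conjRoot hC (x M) f₀.1 (C.inclYdduu g) : D.GtpTheta),
                (D.lDeltaTheta_normal l).conj_mem _ (hf₀.1 _) _⟩) ∧
          (∀ (M M' : Es), ((M : ℕ+) ∣ M') → ∀ g : (C.thetaEnvTower τ hC hS).PiYdd,
            (τ.mod M).red ⟨(C.conjRoot hC (x M') f₀.1 (C.inclYdduu g) : D.GtpTheta),
                (D.lDeltaTheta_normal l).conj_mem _ (hf₀.1 _) _⟩ =
              (τ.mod M).red ⟨(C.conjRoot hC (x M) f₀.1 (C.inclYdduu g) : D.GtpTheta),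
                (D.lDeltaTheta_normal l).conj_mem _ (hf₀.1 _) _⟩)) :
    (C.thetaEnvTower τ hC hS).Cor219_iii := by
  intro γ hγ γμ hcompat
  obtain ⟨hK, hL, H'⟩ := H γ hγ γμ hcompat
  obtain ⟨γΛ, hγΛ⟩ := C.exists_lDeltaAut τ hC hS γ.toMulEquiv hK hL
  obtain ⟨f₀, hf₀, x, hH, hX⟩ := H' γΛ hγΛ
  -- the transport `F₀ = Φ_γ f₀` (clauses (a), (b), (c) of `exists_transport`)
  obtain ⟨F₀, hF₀a, hF₀b, hF₀c⟩ := C.exists_transport τ hC hS γ hγ hL γΛ hγΛ f₀ hf₀.1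
  -- the level-`M` quotient `q_M := (red_M ∘ F₀) / (red_M ∘ conjRoot x_M f₀)` on `Π^tp_Ÿ̲̲`
  set q : ∀ M : Es, (C.thetaEnvTower τ hC hS).PiYdd → (C.thetaEnvTower τ hC hS).mu M := fun M g =>
    (τ.mod M).red (F₀ (C.inclYdduu g)) *
      ((τ.mod M).red ⟨(C.conjRoot hC (x M) f₀.1 (C.inclYdduu g) : D.GtpTheta),
        (D.lDeltaTheta_normal l).conj_mem _ (hf₀.1 _) _⟩)⁻¹ with hq
  -- cocycle law of `red_M ∘ F₀` (clause (b) + equivariance of `red`)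
  have hFcoc : ∀ (M : Es) (g h : (C.thetaEnvTower τ hC hS).PiYdd),
      (τ.mod M).red (F₀ (C.inclYdduu (g * h))) =
        (τ.mod M).red (F₀ (C.inclYdduu g)) *
          galMuN p M (D.aug.toMonoidHom ((g : C.Huu) : D.PiTemp)) ((τ.mod M).red (F₀ (C.inclYdduu h))) := by
    intro M g h
    have hb : F₀ (C.inclYdduu (g * h)) = F₀ (C.inclYdduu g) *
        ⟨D.toTheta ((C.inclYdduu g : C.GtpYdduu) : D.PiTemp) * (F₀ (C.inclYdduu h) : D.GtpTheta) *
          (D.toTheta ((C.inclYdduu g : C.GtpYdduu) : D.PiTemp))⁻¹, (D.lDeltaTheta_normal l).conj_mem _ (F₀ _).2 _⟩ := by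
      apply Subtype.ext
      rw [map_mul, hF₀b, Subgroup.coe_mul]
    rw [hb, map_mul, (τ.mod M).red_conj]
    rfl
  -- cocycle law of `red_M ∘ conjRoot x_M f₀` (a mod-`M` theta cocycle)
  have hRcoc : ∀ (M : Es) (g h : (C.thetaEnvTower τ hC hS).PiYdd),
      (τ.mod M).red ⟨(C.conjRoot hC (x M) f₀.1 (C.inclYdduu (g * h)) : D.GtpTheta),
          (D.lDeltaTheta_normal l).conj_mem _ (hf₀.1 _) _⟩ =
        (τ.mod M).red ⟨(C.conjRoot hC (x M) f₀.1 (C.inclYdduu g) : D.GtpTheta),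
            (D.lDeltaTheta_normal l).conj_mem _ (hf₀.1 _) _⟩ *
          galMuN p M (D.aug.toMonoidHom ((g : C.Huu) : D.PiTemp))
            ((τ.mod M).red ⟨(C.conjRoot hC (x M) f₀.1 (C.inclYdduu h) : D.GtpTheta),
              (D.lDeltaTheta_normal l).conj_mem _ (hf₀.1 _) _⟩) := by
    intro M g h
    rw [C.red_conjRoot_eq_conjCocycle τ hC hS M f₀ hf₀ (x M), C.red_conjRoot_eq_conjCocycle τ hC hS M f₀ hf₀ (x M),
      C.red_conjRoot_eq_conjCocycle τ hC hS M f₀ hf₀ (x M)]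
    exact (C.thetaEnvTower τ hC hS).isCocycle M _ (C.thetaEnvTower_conjCocycle_mem τ hC hS M (x M) ⟨f₀, hf₀, rfl⟩) g h
  -- hence the cocycle law of `q_M`, its vanishing on `Δ_P`, and its local constancy
  have hqcoc : ∀ (M : Es) (g h : (C.thetaEnvTower τ hC hS).PiYdd), q M (g * h) =
      q M g * (C.thetaEnvTower τ hC hS).chi M ((C.thetaEnvTower τ hC hS).aug (g : (C.thetaEnvTower τ hC hS).PiX))
        (q M h) := by
    intro M g h
    change _ = _ * galMuN p M (D.aug.toMonoidHom ((g : C.Huu) : D.PiTemp)) _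
    simp only [hq]
    rw [hFcoc, hRcoc, map_mul, map_inv, mul_inv]
    apply (Additive.ofMul : (C.thetaEnvTower τ hC hS).mu M ≃ Additive ((C.thetaEnvTower τ hC hS).mu M)).injective
    simp only [ofMul_mul, ofMul_inv]
    abel
  have hqvan : ∀ (M : Es) (g : (C.thetaEnvTower τ hC hS).PiYdd),
      (C.thetaEnvTower τ hC hS).aug (g : (C.thetaEnvTower τ hC hS).PiX) = 1 → q M g = 1 := by
    intro M g hg
    have hg' : D.aug.toMonoidHom ((g : C.Huu) : D.PiTemp) = 1 := congrArg Subtype.val hg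
    simp only [hq]
    rw [hF₀a, hH M g hg', mul_inv_cancel]
  have hqlc : ∀ M : Es, IsLocallyConstant (q M) := fun M =>
    (C.transport_red_isLocallyConstant τ hC hS M γ hγ (γμ M) hf₀ F₀ (hF₀c M (γμ M) (hcompat M))).mul
      (C.conjRoot_red_isLocallyConstant τ hC hS M hf₀ (x M)).inv
  -- G7 at every level: `q_M = c_M ∘ aug`
  choose c hcenv hclc hcq using fun M : Es =>
    C.exists_envCocycle_of_vanishing τ hC hS M (q M) (hqcoc M) (hqvan M) (hqlc M) hopen
  refine ⟨c, hcenv, hclc, fun M M' h => ?_, fun M => ?_⟩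
  · -- compatibility across levels: `red ∘ c_{M'} = c_M`
    funext s
    let g : (C.thetaEnvTower τ hC hS).PiYdd :=
      ⟨⟨(C.lift s : D.PiTemp), (Subgroup.mem_inf.1 (C.lift s).2).2⟩, (Subgroup.mem_inf.1 (C.lift s).2).1⟩
    have hgs : (C.thetaEnvTower τ hC hS).aug (g : (C.thetaEnvTower τ hC hS).PiX) = s := Subtype.ext (C.aug_lift s)
    rw [Function.comp_apply, ← hgs, ← hcq M' g, ← hcq M g]
    simp only [hq]
    change MuN.red p M M' (pnat_dvd h) _ = _
    rw [map_mul, map_inv, τ.red_mod, τ.red_mod, hX M M' h g]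
  · -- the level-`M` clause, by `pullback_image_eq_of_heart_of_noTorsion` with the heart read off `q_M = c_M ∘ aug`
    refine C.pullback_image_eq_of_heart_of_noTorsion τ hC hS hT M γ hγ hL γΛ hγΛ (γμ M) (hcompat M) f₀ hf₀ (x M) (c M)
      (hcenv M) fun g => ?_
    have h1 := hcq M g
    simp only [hq] at h1
    rw [hF₀a] at h1
    rw [← C.red_conjRoot_eq_conjCocycle τ hC hS M f₀ hf₀ (x M) g, mul_comm, ← h1, inv_mul_cancel_right]

/-- **`hopen` from the openness of `Π^tp_X → G_{ℚ_p}`.**  If the augmentation `aug : Π^tp_X → G_{ℚ_p}` of the theta setting is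
an open map (true at the models of record, cf. `isOpenMap_augχ`), then so is `aug|_{Π^tp_Ÿ̲̲} : Π^tp_Ÿ̲̲ → G_K` in tower currency
(`Π^tp_Ÿ̲̲ ⊆ Π^tp_X̲̲ ⊆ Π^tp_X` are open subgroups; `G_K ⊆ G_{ℚ_p}` carries the subspace topology) — the hypothesis `hopen` of
`cor219_iii_of_hearts` / part 2a's `exists_envCocycle_of_vanishing`. [cite: MochizukiEtTh2009, Prop 2.2 (iii) p.37] -/
theorem isOpenMap_aug_PiYdd (hC : D.Compat) (hS : D.Sec2Hyps) (haug : IsOpenMap D.aug) :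
    IsOpenMap fun g : (C.thetaEnvTower τ hC hS).PiYdd =>
      (C.thetaEnvTower τ hC hS).aug (g : (C.thetaEnvTower τ hC hS).PiX) := by
  intro U hU
  have h1 : IsOpen ((fun g : (C.thetaEnvTower τ hC hS).PiYdd =>
      (((g : (C.thetaEnvTower τ hC hS).PiX)) : D.PiTemp)) '' U) := by
    have e1 : Topology.IsOpenEmbedding (fun g : (C.thetaEnvTower τ hC hS).PiYdd => (g : (C.thetaEnvTower τ hC hS).PiX)) :=
      (C.thetaEnvTower τ hC hS).PiYdd_open.isOpenEmbedding_subtypeVal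
    have e2 : Topology.IsOpenEmbedding (fun x : (C.thetaEnvTower τ hC hS).PiX => (x : D.PiTemp)) :=
      C.isOpen_Huu.isOpenEmbedding_subtypeVal
    exact (e2.comp e1).isOpenMap U hU
  have h3 : (fun g : (C.thetaEnvTower τ hC hS).PiYdd => (C.thetaEnvTower τ hC hS).aug (g : (C.thetaEnvTower τ hC hS).PiX)) '' U =
      Subtype.val ⁻¹' (D.aug '' ((fun g : (C.thetaEnvTower τ hC hS).PiYdd =>
        (((g : (C.thetaEnvTower τ hC hS).PiX)) : D.PiTemp)) '' U)) := by
    ext s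
    simp only [Set.mem_image, Set.mem_preimage]
    constructor
    · rintro ⟨g, hg, rfl⟩
      exact ⟨_, ⟨g, hg, rfl⟩, rfl⟩
    · rintro ⟨_, ⟨g, hg, rfl⟩, hs⟩
      exact ⟨g, hg, Subtype.ext hs⟩
  rw [h3]
  exact (haug _ h1).preimage continuous_subtype_val

/-! ## §2. At an ORIGIN: the no-`l`-torsion binder is abc-iut-L2-t8's theorem `deltaTheta_torsionfree` -/

/-- **G9 at an origin**: `cor219_iii_of_hearts` with the no-`l`-torsion binder discharged by abc-iut-L2-t8's
`ThetaSetting.deltaTheta_torsionfree` (`l ≠ 0` for `X̲̲`, `DoubleUnderline.l_ne_zero`; the named L6 form of this discharge is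
`Literature.IUT.HodgeArakelov.EtaleThetaDataOfSetting.deltaTheta_pow_eq_one_imp_of_isEtThOrigin`, not imported here to keep the
§2 file below layer L6) — over an origin setting with open augmentation on `Π^tp_Ÿ̲̲`, compatible level-wise hearts for every
`(γ, γ̄)` imply `T.Cor219_iii`. [cite: MochizukiEtTh2009, Cor 2.19(iii) p.65] -/
theorem cor219_iii_of_hearts_of_origin (hO : D.IsEtThOrigin) (hC : D.Compat) (hS : D.Sec2Hyps)
    (hopen : IsOpenMap fun g : (C.thetaEnvTower τ hC hS).PiYdd =>
      (C.thetaEnvTower τ hC hS).aug (g : (C.thetaEnvTower τ hC hS).PiX))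
    (H : ∀ (γ : (C.thetaEnvTower τ hC hS).PiX ≃ₜ* (C.thetaEnvTower τ hC hS).PiX)
      (hγ : (C.thetaEnvTower τ hC hS).PiYdd.map γ.toMulEquiv.toMonoidHom = (C.thetaEnvTower τ hC hS).PiYdd)
      (γμ : ∀ M : Es, (C.thetaEnvTower τ hC hS).mu M ≃* (C.thetaEnvTower τ hC hS).mu M)
      (_ : ∀ (M : Es) (g : (C.thetaEnvTower τ hC hS).lDeltaTheta) (hg : γ g ∈ (C.thetaEnvTower τ hC hS).lDeltaTheta),
        (C.thetaEnvTower τ hC hS).thetaMod M ⟨γ g, hg⟩ = γμ M ((C.thetaEnvTower τ hC hS).thetaMod M g)),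
      (D.toTheta.comp C.Huu.subtype).ker.map γ.toMulEquiv.toMonoidHom = (D.toTheta.comp C.Huu.subtype).ker ∧
      (C.thetaEnvTower τ hC hS).lDeltaTheta.map γ.toMulEquiv.toMonoidHom = (C.thetaEnvTower τ hC hS).lDeltaTheta ∧
      ∀ (γΛ : D.lDeltaTheta l ≃* D.lDeltaTheta l)
        (_ : ∀ (g : (C.thetaEnvTower τ hC hS).lDeltaTheta) (hg : γ g ∈ (C.thetaEnvTower τ hC hS).lDeltaTheta),
          C.toLDelta ⟨γ g, hg⟩ = γΛ (C.toLDelta g)),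
        ∃ (f₀ : contCocycles D.toTheta D.DeltaTheta C.GtpYdduu) (hf₀ : f₀ ∈ C.rootCocycles hC)
          (x : Es → (C.thetaEnvTower τ hC hS).PiX),
          (∀ (M : Es) (g : (C.thetaEnvTower τ hC hS).PiYdd), D.aug.toMonoidHom ((g : C.Huu) : D.PiTemp) = 1 →
            (τ.mod M).red (γΛ.symm ⟨(f₀.1 (C.inclYdduu ⟨γ g, C.apply_mem_PiYdd τ hC hS γ hγ g⟩) : D.GtpTheta),
              hf₀.1 _⟩) =
              (τ.mod M).red ⟨(C.conjRoot hC (x M) f₀.1 (C.inclYdduu g) : D.GtpTheta),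
                (D.lDeltaTheta_normal l).conj_mem _ (hf₀.1 _) _⟩) ∧
          (∀ (M M' : Es), ((M : ℕ+) ∣ M') → ∀ g : (C.thetaEnvTower τ hC hS).PiYdd,
            (τ.mod M).red ⟨(C.conjRoot hC (x M') f₀.1 (C.inclYdduu g) : D.GtpTheta),
                (D.lDeltaTheta_normal l).conj_mem _ (hf₀.1 _) _⟩ =
              (τ.mod M).red ⟨(C.conjRoot hC (x M) f₀.1 (C.inclYdduu g) : D.GtpTheta),
                (D.lDeltaTheta_normal l).conj_mem _ (hf₀.1 _) _⟩)) :
    (C.thetaEnvTower τ hC hS).Cor219_iii :=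
  C.cor219_iii_of_hearts τ hC hS
    (fun t ht => Subtype.ext (D.deltaTheta_torsionfree hO t.2 C.l_ne_zero
      (by rw [← Subgroup.coe_pow, ht, Subgroup.coe_one])))
    hopen H

end ThetaSetting.EtaleThetaData.DoubleUnderline

end Literature.AnabelianGeometry.EtaleTheta

end
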